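import Literature.NumberTheory.LFunctions.DedekindZetaUniformBounds
import Literature.NumberTheory.LFunctions.DedekindZetaEntireConvexity
import Literature.NumberTheory.LFunctions.ZetaZeroFreeRegion
import Literature.NumberTheory.LFunctions.ZetaLogDerivDisc
import Literature.NumberTheory.LFunctions.ZetaConvexityExplicit
import Literature.NumberTheory.LFunctions.MontgomeryVaughan2001PrimeSums
import HarnessLib

/-!
# `ζ_K(σ) ≤ ζ(σ)^{[K:ℚ]} ≤ (σ/(σ−1))^{[K:ℚ]}` on the real axis, and the gamma factor on `[1, 2]`

Topic `Literature/NumberTheory/LFunctions`, namespace `Literature.NumberTheory.LFunctions`.  Everything here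
is PROVED (theorems only, standard axioms).

For a number field `K` of degree `n = [K:ℚ]` and real `σ > 1`:

* `exp_re_logSeries_vonMangoldt_le` — `exp(ℓ(σ)) ≤ ζ(σ) ≤ σ/(σ−1)` for the von Mangoldt log-series
  `ℓ(s) = ∑ Λ(m) m^{-s}/log m` (Mathlib's `Λ`): `(s−1)ζ(s) = C (s−1) e^{ℓ(s)}` on `Re s > 1`
  (`ClassicalZFRData.exists_eq_const_mul_exp_logSeries` with the tree's `classicalZFRData_riemannZeta`),
  `‖C‖ ≥ 1` by letting `σ → +∞` (`ζ(σ) ≥ 1`, `ℓ(σ) → 0`), and `ζ(σ) ≤ σ/(σ−1)`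
  (`MontgomeryVaughan2001.norm_zeta_real_le`);
* `re_logSeries_vonMangoldtIdeal_le` — `ℓ_K(σ) ≤ n · ℓ(σ)` termwise from `Λ_K(m) ≤ n Λ(m)`
  (`vonMangoldtIdeal_le_finrank_mul_vonMangoldt`);
* `norm_dedekindZeta_ofReal_le_pow` — **`ζ_K(σ) ≤ (σ/(σ−1))^n`** (Lagarias–Odlyzko 1977 §5:
  `ζ_K(σ) ≤ ζ(σ)^{n_K}`; the tree so far had only `ζ_K(σ) ≤ e^{n/(σ−1)}`, `norm_dedekindZeta_le_exp_finrank_div`);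
* `norm_dedekindZeta₁_ofReal_le` — `‖ζ₁_K(σ)‖ ≤ (σ − 1)(σ/(σ−1))^n`;
* (appendix) `norm_riemannZeta_ofReal_eq_exp_re_logSeries` — `ζ(σ) = e^{ℓ(σ)}` (the constant IS `1`) and
  `norm_dedekindZeta_ofReal_le_norm_riemannZeta_pow` — **`ζ_K(σ) ≤ ζ(σ)^{[K:ℚ]}`** exactly;
* `norm_dedekindGammaFactor_le_rpow_mul` — for `1 ≤ σ ≤ 2`,
  `‖γ_K(σ)‖ ≤ |d_K|^{(σ−1)/2} ‖γ_K(1)‖` for the gamma factor `γ_K(s) = |d_K|^{s/2} Γ_ℝ(s)^{r₁} Γ_ℂ(s)^{r₂}`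
  (`Γ_ℝ(σ) ≤ 1 = Γ_ℝ(1)`, `Γ_ℂ(σ) ≤ 1/π = Γ_ℂ(1)` on `[1,2]` by convexity of `Γ`), with the real
  lemma `Real.Gamma_le_sqrt_pi_of_mem_Icc` (`Γ ≤ √π` on `[1/2,1]`; `Γ ≤ 1` on `[1,2]` is the tree's
  `Real.Gamma_le_one_of_mem_Icc`).

These are the inputs of Landau's upper bound `κ_K ≪ log^{n−1}|d_K|` (Louboutin's method; cell B2b-1's
`…ResidueUpper.lean`).  Value = theorem (reproduction), NOT summit progress.

## References
* J. C. Lagarias, A. M. Odlyzko, *Effective versions of the Chebotarev density theorem* (1977), §5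
  (`ζ_K(σ) ≤ ζ(σ)^{n_K}`). [LagariasOdlyzko1977]
* S. Louboutin, J. Number Theory 85 (2000) 263–282 (the use of `ζ_K(σ) ≤ ζ(σ)^n` and of the gamma
  factors on `[1,2]`). [Louboutin2000]
* E. C. Titchmarsh, *The Theory of the Riemann Zeta-Function*, §2.1 (2.1.4) (`ζ(σ) ≤ σ/(σ−1)`). [Titchmarsh1986]
-/

noncomputable section

open Complex Filter Topology NumberField NumberField.InfinitePlace

namespace Literature.NumberTheory.LFunctions

open Literature.NumberTheory.LFunctions.NumberField

/-! ### Real Gamma on `[1/2, 2]` -/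

/-- `Γ(x) ≤ √π` for `1/2 ≤ x ≤ 1` (convexity of `Γ`, `Γ(1/2) = √π ≥ 1 = Γ(1)`). [folklore] -/
theorem Real.Gamma_le_sqrt_pi_of_mem_Icc {x : ℝ} (h1 : 1 / 2 ≤ x) (h2 : x ≤ 1) :
    Real.Gamma x ≤ Real.sqrt Real.pi := by
  have h := Real.convexOn_Gamma.le_on_segment (x := 1 / 2) (y := 1) (z := x) (by norm_num) (by norm_num)
    (by rw [segment_eq_Icc (by norm_num : (1 / 2 : ℝ) ≤ 1)]; exact ⟨h1, h2⟩)
  rw [Real.Gamma_one_half_eq, Real.Gamma_one] at h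
  refine h.trans (max_le le_rfl ?_)
  rw [show (1 : ℝ) = Real.sqrt 1 by simp]
  exact Real.sqrt_le_sqrt (by linarith [Real.pi_gt_three])

/-- `‖Γ_ℝ(σ)‖ ≤ 1` for real `1 ≤ σ ≤ 2` (`π^{−σ/2} ≤ π^{−1/2}`, `Γ(σ/2) ≤ √π`). [folklore] -/
theorem norm_Gammaℝ_ofReal_le_one {σ : ℝ} (h1 : 1 ≤ σ) (h2 : σ ≤ 2) : ‖Gammaℝ (σ : ℂ)‖ ≤ 1 := by
  rw [Gammaℝ_def, norm_mul]
  have hpi : ‖(Real.pi : ℂ) ^ (-(σ : ℂ) / 2)‖ = Real.pi ^ (-σ / 2) := by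
    rw [Complex.norm_cpow_eq_rpow_re_of_pos Real.pi_pos]
    congr 1
    simp
  have hG : ‖Complex.Gamma ((σ : ℂ) / 2)‖ = Real.Gamma (σ / 2) := by
    rw [show (σ : ℂ) / 2 = ((σ / 2 : ℝ) : ℂ) by push_cast; ring, Complex.Gamma_ofReal, Complex.norm_real,
      Real.norm_of_nonneg (Real.Gamma_pos_of_pos (by linarith)).le]
  rw [hpi, hG]
  have hpi1 : (1 : ℝ) ≤ Real.pi := by linarith [Real.pi_gt_three]
  have h1' : Real.pi ^ (-σ / 2) ≤ Real.pi ^ (-(1 : ℝ) / 2) :=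
    Real.rpow_le_rpow_of_exponent_le hpi1 (by linarith)
  have h1'' : Real.pi ^ (-(1 : ℝ) / 2) * Real.sqrt Real.pi = 1 := by
    rw [Real.sqrt_eq_rpow, ← Real.rpow_add Real.pi_pos]
    norm_num
  have h2' : Real.Gamma (σ / 2) ≤ Real.sqrt Real.pi :=
    Real.Gamma_le_sqrt_pi_of_mem_Icc (by linarith) (by linarith)
  calc Real.pi ^ (-σ / 2) * Real.Gamma (σ / 2) ≤ Real.pi ^ (-(1 : ℝ) / 2) * Real.sqrt Real.pi :=
        mul_le_mul h1' h2' (Real.Gamma_pos_of_pos (by linarith)).le (Real.rpow_nonneg Real.pi_pos.le _)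
    _ = 1 := h1''

/-- `‖Γ_ℂ(σ)‖ ≤ ‖Γ_ℂ(1)‖ = 1/π` for real `1 ≤ σ ≤ 2` (`(2π)^{−σ} ≤ (2π)^{−1}`, `Γ(σ) ≤ 1`). [folklore] -/
theorem norm_Gammaℂ_ofReal_le {σ : ℝ} (h1 : 1 ≤ σ) (h2 : σ ≤ 2) :
    ‖Gammaℂ (σ : ℂ)‖ ≤ ‖Gammaℂ (1 : ℂ)‖ := by
  rw [Gammaℂ_one, Gammaℂ_def, norm_mul, norm_mul]
  have h2π : ‖(2 * (Real.pi : ℂ)) ^ (-(σ : ℂ))‖ = (2 * Real.pi) ^ (-σ) := by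
    rw [show (2 * (Real.pi : ℂ)) = ((2 * Real.pi : ℝ) : ℂ) by push_cast; ring,
      Complex.norm_cpow_eq_rpow_re_of_pos (by positivity)]
    simp
  have hG : ‖Complex.Gamma (σ : ℂ)‖ = Real.Gamma σ := by
    rw [Complex.Gamma_ofReal, Complex.norm_real, Real.norm_of_nonneg (Real.Gamma_pos_of_pos (by linarith)).le]
  have hone : ‖(1 / Real.pi : ℂ)‖ = 1 / Real.pi := by
    rw [show (1 / Real.pi : ℂ) = ((1 / Real.pi : ℝ) : ℂ) by push_cast; ring, Complex.norm_real,
      Real.norm_of_nonneg (by positivity)]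
  rw [h2π, hG, hone, Complex.norm_two]
  have hb1 : (1 : ℝ) ≤ 2 * Real.pi := by linarith [Real.pi_gt_three]
  have h3 : (2 * Real.pi) ^ (-σ) ≤ (2 * Real.pi) ^ (-(1 : ℝ)) :=
    Real.rpow_le_rpow_of_exponent_le hb1 (by linarith)
  have h4 : (2 * Real.pi) ^ (-(1 : ℝ)) = 1 / (2 * Real.pi) := by
    rw [Real.rpow_neg_one, one_div]
  have h5 : Real.Gamma σ ≤ 1 := Real.Gamma_le_one_of_mem_Icc h1 h2
  calc 2 * (2 * Real.pi) ^ (-σ) * Real.Gamma σ ≤ 2 * (1 / (2 * Real.pi)) * 1 := by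
        rw [← h4]
        exact mul_le_mul (mul_le_mul_of_nonneg_left h3 (by norm_num)) h5
          (Real.Gamma_pos_of_pos (by linarith)).le (by positivity)
    _ = 1 / Real.pi := by field_simp

/-- **The gamma factor on `[1, 2]` against its value at `1`**: for real `1 ≤ σ ≤ 2`,
`‖γ_K(σ)‖ ≤ |d_K|^{(σ−1)/2} · ‖γ_K(1)‖`, where `γ_K(s) = |d_K|^{s/2} Γ_ℝ(s)^{r₁} Γ_ℂ(s)^{r₂}`
(`dedekindGammaFactor`). [cite: Louboutin2000, §2 (gamma factors on the real segment)] -/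
theorem norm_dedekindGammaFactor_le_rpow_mul (K : Type*) [Field K] [NumberField K] {σ : ℝ}
    (h1 : 1 ≤ σ) (h2 : σ ≤ 2) :
    ‖dedekindGammaFactor K σ‖ ≤
      ((discr K).natAbs : ℝ) ^ ((σ - 1) / 2) * ‖dedekindGammaFactor K 1‖ := by
  set d : ℝ := ((discr K).natAbs : ℝ) with hd
  have hd1 : (1 : ℝ) ≤ d := by
    rw [hd]; exact_mod_cast Nat.one_le_iff_ne_zero.mpr (Int.natAbs_ne_zero.mpr (discr_ne_zero K))
  have hd0 : 0 < d := by linarith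
  have hdC : ((discr K).natAbs : ℂ) = ((d : ℝ) : ℂ) := by rw [hd]; push_cast; rfl
  unfold dedekindGammaFactor
  rw [norm_mul, norm_mul, norm_pow, norm_pow, norm_mul, norm_mul, norm_pow, norm_pow, hdC,
    Complex.norm_cpow_eq_rpow_re_of_pos hd0, Complex.norm_cpow_eq_rpow_re_of_pos hd0, Gammaℝ_one,
    norm_one, one_pow, mul_one]
  have hre1 : ((1 : ℂ) / 2).re = 1 / 2 := by simp
  have hreσ : ((σ : ℂ) / 2).re = σ / 2 := by simp
  rw [hre1, hreσ]
  -- the pieces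
  have hdpow : d ^ (σ / 2) = d ^ ((σ - 1) / 2) * d ^ ((1 : ℝ) / 2) := by
    rw [← Real.rpow_add hd0]; ring_nf
  have hR : ‖Gammaℝ (σ : ℂ)‖ ^ nrRealPlaces K ≤ 1 :=
    pow_le_one₀ (norm_nonneg _) (norm_Gammaℝ_ofReal_le_one h1 h2)
  have hC : ‖Gammaℂ (σ : ℂ)‖ ^ nrComplexPlaces K ≤ ‖Gammaℂ (1 : ℂ)‖ ^ nrComplexPlaces K :=
    pow_le_pow_left₀ (norm_nonneg _) (norm_Gammaℂ_ofReal_le h1 h2) _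
  have hA0 : 0 ≤ d ^ ((σ - 1) / 2) * d ^ ((1 : ℝ) / 2) := by positivity
  calc d ^ (σ / 2) * ‖Gammaℝ (σ : ℂ)‖ ^ nrRealPlaces K * ‖Gammaℂ (σ : ℂ)‖ ^ nrComplexPlaces K
      ≤ (d ^ ((σ - 1) / 2) * d ^ ((1 : ℝ) / 2)) * 1 * ‖Gammaℂ (1 : ℂ)‖ ^ nrComplexPlaces K := by
        rw [hdpow]
        exact mul_le_mul (mul_le_mul_of_nonneg_left hR hA0) hC (pow_nonneg (norm_nonneg _) _)
          (by positivity)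
    _ = d ^ ((σ - 1) / 2) * (d ^ ((1 : ℝ) / 2) * ‖Gammaℂ (1 : ℂ)‖ ^ nrComplexPlaces K) := by ring

/-! ### `ζ(σ) = C e^{ℓ(σ)}` with `‖C‖ ≥ 1`, hence `e^{ℓ(σ)} ≤ ζ(σ) ≤ σ/(σ−1)` -/

/-- There is `c ≥ 1` with `‖ζ(σ)‖ = c · exp(Re ℓ(σ))` for every real `σ > 1`, where
`ℓ(s) = ∑ Λ(m) m^{-s}/log m` (`ClassicalZFRData.logSeries` of Mathlib's von Mangoldt function):
`(s−1)ζ(s) = C(s−1)e^{ℓ(s)}` (`exists_eq_const_mul_exp_logSeries`, `classicalZFRData_riemannZeta`) and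
`‖C‖ ≥ 1` because `ζ(σ) ≥ 1` while `ℓ(σ) → 0` as `σ → +∞`.  (In fact `C = 1`; not needed.) [folklore] -/
theorem exists_norm_riemannZeta_ofReal_eq_mul_exp :
    ∃ c : ℝ, 1 ≤ c ∧ ∀ σ : ℝ, 1 < σ →
      ‖riemannZeta σ‖ = c * Real.exp
        (ClassicalZFRData.logSeries (fun n ↦ ArithmeticFunction.vonMangoldt n) σ).re := by
  set Λ : ℕ → ℝ := fun n ↦ ArithmeticFunction.vonMangoldt n with hΛdef
  have hD := classicalZFRData_riemannZeta
  have hDiff : DifferentiableOn ℂ riemannZeta₁ {s : ℂ | 1 < s.re} :=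
    hD.differentiableOn.mono fun s hs ↦ by
      simp only [Set.mem_setOf_eq] at hs ⊢; linarith
  obtain ⟨C, hC0, hC⟩ := ClassicalZFRData.exists_eq_const_mul_exp_logSeries hD.nonneg hD.map_one
    hD.summable hDiff hD.ne_zero hD.logDeriv_eq
  have key : ∀ σ : ℝ, 1 < σ →
      ‖riemannZeta σ‖ = ‖C‖ * Real.exp (ClassicalZFRData.logSeries Λ σ).re := by
    intro σ hσ
    have hσ' : 1 < (σ : ℂ).re := by simpa using hσ
    have hne : (σ : ℂ) ≠ 1 := by
      intro h; have := congrArg Complex.re h; simp at this; linarith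
    have hsub : (σ : ℂ) - 1 ≠ 0 := sub_ne_zero.mpr hne
    have h := hC σ hσ'
    rw [riemannZeta₁_eq_mul hne] at h
    have hζ : riemannZeta σ = C * Complex.exp (ClassicalZFRData.logSeries Λ σ) := by
      have h' : ((σ : ℂ) - 1) * riemannZeta σ = ((σ : ℂ) - 1) * (C * Complex.exp (ClassicalZFRData.logSeries Λ σ)) := by
        rw [h]; ring
      exact mul_left_cancel₀ hsub h'
    rw [hζ, norm_mul, Complex.norm_exp]
  refine ⟨‖C‖, ?_, key⟩
  -- `‖C‖ ≥ 1`: `1 ≤ ‖ζ(σ)‖ = ‖C‖ e^{Re ℓ(σ)}` and `ℓ(σ) → 0`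
  have habs : LSeries.abscissaOfAbsConv (fun n ↦ ((Λ n / Real.log n : ℝ) : ℂ)) < ⊤ :=
    lt_of_le_of_lt (ClassicalZFRData.abscissaOfAbsConv_div_log_le hD.nonneg hD.summable)
      (EReal.coe_lt_top 1)
  have hlimℓ : Tendsto (fun x : ℝ ↦ ClassicalZFRData.logSeries Λ x) atTop (𝓝 0) := by
    have h := LSeries.tendsto_atTop habs
    have h0 : ((Λ 1 / Real.log (1 : ℕ) : ℝ) : ℂ) = 0 := by simp
    rw [h0] at h
    simpa [ClassicalZFRData.logSeries] using h
  have hlim : Tendsto (fun x : ℝ ↦ ‖C‖ * Real.exp (ClassicalZFRData.logSeries Λ x).re) atTop (𝓝 ‖C‖) := by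
    have h1 : Tendsto (fun x : ℝ ↦ (ClassicalZFRData.logSeries Λ x).re) atTop (𝓝 0) := by
      have := (Complex.continuous_re.tendsto 0).comp hlimℓ
      simpa [Function.comp_def] using this
    have h2 : Tendsto (fun x : ℝ ↦ Real.exp (ClassicalZFRData.logSeries Λ x).re) atTop (𝓝 1) := by
      have := (Real.continuous_exp.tendsto 0).comp h1
      simpa [Function.comp_def] using this
    simpa using h2.const_mul ‖C‖
  refine ge_of_tendsto hlim ?_
  filter_upwards [eventually_gt_atTop 1] with x hx
  rw [← key x hx]
  exact (one_le_re_riemannZeta_ofReal hx).trans (Complex.re_le_norm _)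

/-- **`exp(Re ℓ(σ)) ≤ σ/(σ−1)`** for real `σ > 1` (`≤ ζ(σ) ≤ σ/(σ−1)`). [cite: Titchmarsh1986, §2.1 eq. (2.1.4)] -/
theorem exp_re_logSeries_vonMangoldt_le {σ : ℝ} (hσ : 1 < σ) :
    Real.exp (ClassicalZFRData.logSeries (fun n ↦ ArithmeticFunction.vonMangoldt n) σ).re ≤
      σ / (σ - 1) := by
  obtain ⟨c, hc1, hc⟩ := exists_norm_riemannZeta_ofReal_eq_mul_exp
  have h := hc σ hσ
  have hζ := MontgomeryVaughan2001.norm_zeta_real_le hσ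
  have hE : 0 < Real.exp (ClassicalZFRData.logSeries (fun n ↦ ArithmeticFunction.vonMangoldt n) σ).re :=
    Real.exp_pos _
  calc Real.exp (ClassicalZFRData.logSeries (fun n ↦ ArithmeticFunction.vonMangoldt n) σ).re
      ≤ c * Real.exp (ClassicalZFRData.logSeries (fun n ↦ ArithmeticFunction.vonMangoldt n) σ).re :=
        le_mul_of_one_le_left hE.le hc1
    _ = ‖riemannZeta σ‖ := h.symm
    _ ≤ σ / (σ - 1) := hζ

/-! ### `ℓ_K(σ) ≤ [K:ℚ] · ℓ(σ)` and `ζ_K(σ) ≤ (σ/(σ−1))^{[K:ℚ]}` -/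

variable (K : Type*) [Field K] [NumberField K]

/-- The real part of a term of a log-series with real coefficients at a real point. [folklore] -/
theorem re_term_ofReal_div_log (f : ℕ → ℝ) (σ : ℝ) (n : ℕ) :
    (LSeries.term (fun m ↦ ((f m / Real.log m : ℝ) : ℂ)) (σ : ℂ) n).re =
      if n = 0 then 0 else f n / Real.log n * (n : ℝ) ^ (-σ) := by
  rcases eq_or_ne n 0 with rfl | hn
  · simp
  rw [LSeries.term_of_ne_zero hn, if_neg hn]
  have hcpow : (n : ℂ) ^ (σ : ℂ) = ((n : ℝ) ^ σ : ℝ) := by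
    rw [Complex.ofReal_cpow (Nat.cast_nonneg n)]; simp
  rw [hcpow, ← Complex.ofReal_div, Complex.ofReal_re, Real.rpow_neg (Nat.cast_nonneg n),
    div_eq_mul_inv]

/-- **`Re ℓ_K(σ) ≤ [K:ℚ] · Re ℓ(σ)`** for real `σ > 1`: termwise `Λ_K(m) ≤ [K:ℚ] Λ(m)`
(`vonMangoldtIdeal_le_finrank_mul_vonMangoldt`). [folklore] -/
theorem re_logSeries_vonMangoldtIdeal_le {σ : ℝ} (hσ : 1 < σ) :
    (ClassicalZFRData.logSeries (vonMangoldtIdeal K) σ).re ≤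
      Module.finrank ℚ K *
        (ClassicalZFRData.logSeries (fun n ↦ ArithmeticFunction.vonMangoldt n) σ).re := by
  set n : ℕ := Module.finrank ℚ K with hndef
  set Λ : ℕ → ℝ := fun m ↦ ArithmeticFunction.vonMangoldt m with hΛdef
  have hσ' : 1 < (σ : ℂ).re := by simp [hσ]
  set fK : ℕ → ℂ := fun m ↦ ((vonMangoldtIdeal K m / Real.log m : ℝ) : ℂ) with hfK
  set f : ℕ → ℂ := fun m ↦ ((Λ m / Real.log m : ℝ) : ℂ) with hf
  have hsumK : LSeriesSummable fK (σ : ℂ) :=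
    ClassicalZFRData.LSeriesSummable_div_log (vonMangoldtIdeal_nonneg K)
      (fun s hs ↦ LSeriesSummable_vonMangoldtIdeal K hs) hσ'
  have hsum : LSeriesSummable f (σ : ℂ) :=
    ClassicalZFRData.LSeriesSummable_div_log classicalZFRData_riemannZeta.nonneg
      classicalZFRData_riemannZeta.summable hσ'
  rw [ClassicalZFRData.logSeries, ClassicalZFRData.logSeries, LSeries, LSeries,
    Complex.re_tsum hsumK, Complex.re_tsum hsum, ← tsum_mul_left]
  have hsreK : Summable fun m ↦ (LSeries.term fK (σ : ℂ) m).re := (Complex.hasSum_re hsumK.hasSum).summable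
  have hsre : Summable fun m ↦ (n : ℝ) * (LSeries.term f (σ : ℂ) m).re :=
    ((Complex.hasSum_re hsum.hasSum).summable).mul_left _
  refine Summable.tsum_le_tsum (fun m ↦ ?_) hsreK hsre
  rw [hfK, hf, re_term_ofReal_div_log, re_term_ofReal_div_log]
  split_ifs with hm
  · simp
  · have hlog : 0 ≤ Real.log m := Real.log_natCast_nonneg m
    have hpow : 0 ≤ (m : ℝ) ^ (-σ) := Real.rpow_nonneg (Nat.cast_nonneg m) _
    have hle : vonMangoldtIdeal K m ≤ n * Λ m := by
      rw [hndef, hΛdef]; exact vonMangoldtIdeal_le_finrank_mul_vonMangoldt K m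
    calc vonMangoldtIdeal K m / Real.log m * (m : ℝ) ^ (-σ)
        ≤ (n * Λ m) / Real.log m * (m : ℝ) ^ (-σ) :=
          mul_le_mul_of_nonneg_right (div_le_div_of_nonneg_right hle hlog) hpow
      _ = n * (Λ m / Real.log m * (m : ℝ) ^ (-σ)) := by ring

/-- **`ζ_K(σ) ≤ (σ/(σ−1))^{[K:ℚ]}`** for real `σ > 1` (`ζ_K(σ) = e^{ℓ_K(σ)} ≤ e^{n ℓ(σ)} = ζ(σ)^n`-type
comparison, Lagarias–Odlyzko 1977 §5, and `ζ(σ) ≤ σ/(σ−1)`). [cite: LagariasOdlyzko1977, §5] -/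
theorem norm_dedekindZeta_ofReal_le_pow {σ : ℝ} (hσ : 1 < σ) :
    ‖NumberField.dedekindZeta K σ‖ ≤ (σ / (σ - 1)) ^ Module.finrank ℚ K := by
  have hσ' : 1 < (σ : ℂ).re := by simp [hσ]
  rw [norm_dedekindZeta_eq_exp_re K hσ']
  have h1 := re_logSeries_vonMangoldtIdeal_le K hσ
  have h2 := exp_re_logSeries_vonMangoldt_le hσ
  have hE : 0 ≤ Real.exp (ClassicalZFRData.logSeries (fun n ↦ ArithmeticFunction.vonMangoldt n) σ).re :=
    (Real.exp_pos _).le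
  calc Real.exp (ClassicalZFRData.logSeries (vonMangoldtIdeal K) σ).re
      ≤ Real.exp (Module.finrank ℚ K *
          (ClassicalZFRData.logSeries (fun n ↦ ArithmeticFunction.vonMangoldt n) σ).re) :=
        Real.exp_le_exp.mpr h1
    _ = (Real.exp (ClassicalZFRData.logSeries (fun n ↦ ArithmeticFunction.vonMangoldt n) σ).re) ^
          Module.finrank ℚ K := by rw [← Real.exp_nat_mul]
    _ ≤ (σ / (σ - 1)) ^ Module.finrank ℚ K := pow_le_pow_left₀ hE h2 _

/-- **`‖ζ₁_K(σ)‖ ≤ (σ − 1) · (σ/(σ−1))^{[K:ℚ]}`** for real `σ > 1` (`ζ₁_K(σ) = (σ−1)ζ_K(σ)`). [folklore] -/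
theorem norm_dedekindZeta₁_ofReal_le {σ : ℝ} (hσ : 1 < σ) :
    ‖dedekindZeta₁ K σ‖ ≤ (σ - 1) * (σ / (σ - 1)) ^ Module.finrank ℚ K := by
  have hσ' : 1 < (σ : ℂ).re := by simp [hσ]
  rw [dedekindZeta₁_apply_eq_mul hσ', norm_mul,
    show (σ : ℂ) - 1 = ((σ - 1 : ℝ) : ℂ) by push_cast; ring, Complex.norm_real,
    Real.norm_of_nonneg (by linarith)]
  exact mul_le_mul_of_nonneg_left (norm_dedekindZeta_ofReal_le_pow K hσ) (by linarith)

/-! ### Appendix: the constant is `1`, and `ζ_K(σ) ≤ ζ(σ)^{[K:ℚ]}` exactly -/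

/-- **`‖ζ(σ)‖ = exp(Re ℓ(σ))` for real `σ > 1`** (the constant of
`exists_norm_riemannZeta_ofReal_eq_mul_exp` is `1`: `c ≥ 1` there, and `c ≤ ‖ζ(σ)‖ e^{−Re ℓ(σ)} ≤ ‖ζ(σ)‖ ≤ σ/(σ−1) → 1`).
[folklore] -/
theorem norm_riemannZeta_ofReal_eq_exp_re_logSeries {σ : ℝ} (hσ : 1 < σ) :
    ‖riemannZeta σ‖ =
      Real.exp (ClassicalZFRData.logSeries (fun n ↦ ArithmeticFunction.vonMangoldt n) σ).re := by
  obtain ⟨c, hc1, hc⟩ := exists_norm_riemannZeta_ofReal_eq_mul_exp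
  set Λ : ℕ → ℝ := fun n ↦ ArithmeticFunction.vonMangoldt n with hΛdef
  -- `c ≤ x/(x−1)` for every `x > 1`, hence `c ≤ 1`
  have hcle : ∀ x : ℝ, 1 < x → c ≤ x / (x - 1) := by
    intro x hx
    have h1 := hc x hx
    have h2 := MontgomeryVaughan2001.norm_zeta_real_le hx
    have h3 : 0 ≤ (ClassicalZFRData.logSeries Λ x).re :=
      ClassicalZFRData.logSeries_ofReal_re_nonneg classicalZFRData_riemannZeta.nonneg x
    have h4 : 1 ≤ Real.exp (ClassicalZFRData.logSeries Λ x).re := Real.one_le_exp h3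
    have h5 : c ≤ c * Real.exp (ClassicalZFRData.logSeries Λ x).re :=
      le_mul_of_one_le_right (by linarith) h4
    linarith
  have hc_le_one : c ≤ 1 := by
    -- `x/(x−1) → 1` as `x → ∞`; take `x = 1 + 1/ε`-type values: `c ≤ 1 + 1/(x−1)` for all `x > 1`
    by_contra h
    push Not at h
    -- choose `x = 1 + 2/(c−1)`: then `x/(x−1) = 1 + (c−1)/2 < c`
    have hc0 : 0 < c - 1 := by linarith
    have hx : (1 : ℝ) < 1 + 2 / (c - 1) := by
      have := div_pos (by norm_num : (0:ℝ) < 2) hc0; linarith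
    have h1 := hcle (1 + 2 / (c - 1)) hx
    have h2 : (1 + 2 / (c - 1)) / (1 + 2 / (c - 1) - 1) = 1 + (c - 1) / 2 := by
      field_simp
      ring
    rw [h2] at h1
    linarith
  have hceq : c = 1 := le_antisymm hc_le_one hc1
  rw [hc σ hσ, hceq, one_mul]

/-- **`ζ_K(σ) ≤ ζ(σ)^{[K:ℚ]}`** for real `σ > 1` (Lagarias–Odlyzko 1977, §5; here `ζ_K(σ) = e^{ℓ_K(σ)}`,
`ℓ_K ≤ [K:ℚ]·ℓ`, `e^{ℓ(σ)} = ζ(σ)`). [cite: LagariasOdlyzko1977, §5] -/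
theorem norm_dedekindZeta_ofReal_le_norm_riemannZeta_pow {σ : ℝ} (hσ : 1 < σ) :
    ‖NumberField.dedekindZeta K σ‖ ≤ ‖riemannZeta σ‖ ^ Module.finrank ℚ K := by
  have hσ' : 1 < (σ : ℂ).re := by simp [hσ]
  rw [norm_dedekindZeta_eq_exp_re K hσ', norm_riemannZeta_ofReal_eq_exp_re_logSeries hσ, ← Real.exp_nat_mul]
  exact Real.exp_le_exp.mpr (re_logSeries_vonMangoldtIdeal_le K hσ)

end Literature.NumberTheory.LFunctions

end
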